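import Summits.AtomisticToContinuum.HydrodynamicLimit.Theorems.EnskogAdjointDualityAdjointEnskogTestFamilyROperatorKappaZeroPrep2
import Summits.AtomisticToContinuum.HydrodynamicLimit.Theorems.EnskogAdjointDualityAdjointEnskogTestFamilyROperatorKappaZeroPrep3
import HarnessLib

/-!
# K2R refutation, stub `operatorKappaZero` — preparation 4: the estimate per position slice

Route `EnskogAdjointDuality` of `AtomisticToContinuum/HydrodynamicLimit`, crux K2R
`AdjointEnskogTestFamilyR` (stmt-AtomisticToContinuum-11592), line `refutation`, registered stub
`stub_operatorKappaZero`. Fourth preparation file (notation of `…ROperatorKappaZeroPrep`): the estimate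
at a fixed position `x ∈ 𝕋³` (`k2r_ref_ok0_slice_estimate`). With `Ψ(x, ω) = ∫ κ(x, U) I₀^R(U, ω) dU`,
the loss term `Φ₃ = ∫ Θ₀^R ν κ(x, ·)` and any exchange budget `|Φ₄| ≤ 1040πC`, once the delocalisation
phase has been moved onto `Ψ(x, ·)` the combination
`cos(2πx₀) ∫Ψ(x, ·)dσ + ∫ [cos(2πx₀)cos(kω₀) + sin(2πx₀)sin(kω₀)] Ψ(x, ω) dσ − cos(2πx₀)(Φ₃ + Φ₄)` equals
`π²ε sin(2πx₀) ∫ Θ₀^R U₀ κ(x, U) dU` up to `C M₀' + (k²/2 + k³/6) C Λ + k C M₂' + 1040πC` (`k = 2πε`;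
criticality (K0), the dipole moment (K2), `|cos(kω₀) − 1| ≤ k²/2`, `|sin(kω₀) − kω₀| ≤ k³/6`), together
with the growth bound `ν(v) ≤ 2π(1+|v|²)` (keyed sub-goal `stub_operatorKappaZero_prep4`).

References: C. Cercignani, R. Illner, M. Pulvirenti, *The Mathematical Theory of Dilute Gases* (1994),
§3.1 [CIP1994].
-/

noncomputable section

open MeasureTheory Set Filter Function
open scoped InnerProductSpace Real

namespace Summit.AtomisticToContinuum.HydrodynamicLimit.Theorems.EnskogAdjointDuality

open Literature.MathematicalPhysics.KineticTheory Literature.Analysis.FluidPDE Literature.Analysis.FunctionSpaces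
open Literature.Analysis.UnboundedOperators (collisionFrequency)

variable {Θ : ℝ → V3 → ℝ} {I : ℝ → V3 → V3 → ℝ}
variable (hΘ : ∀ R v, Θ R v = ((1 + ‖v‖ ^ 2) ^ 3)⁻¹ * Real.exp (-‖v‖ ^ 2 / R))
  (hI : ∀ R U n, I R U n = (1 / 2 : ℝ) * Real.exp (-(‖U‖ ^ 2 - ⟪U, n⟫_ℝ ^ 2) / 2) *
    (∫ b, max (⟪U, n⟫_ℝ - b) 0 * (Real.exp (-b ^ 2 / 2) / Real.sqrt (2 * π))) *
    ∫ E in Ioi (⟪U, n⟫_ℝ ^ 2), ((1 + E) ^ 3)⁻¹ * Real.exp (-E / R))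
include hΘ hI

omit hΘ hI in
/-- **Registered keyed sub-goal `stub_operatorKappaZero_prep4`** of stub `stub_operatorKappaZero` (line
`refutation` of crux K2R): the collision frequency of the linearised hard-sphere operator grows at most
quadratically, `ν(v) ≤ 2π(1 + |v|²)` (from `ν(v) ≤ π√(|v|²+3)`, `stub_halfGaussian`). [cite: CIP1994, §7.2 (2.15)] -/
theorem stub_operatorKappaZero_prep4 : ∀ v : EuclideanSpace ℝ (Fin 3), Literature.Analysis.UnboundedOperators.collisionFrequency v ≤ 2 * Real.pi * (1 + ‖v‖ ^ 2) := by
  intro v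
  refine (stub_halfGaussian.2.2.2.2.2 v).2.1.trans ?_
  have h : Real.sqrt (‖v‖ ^ 2 + 3) ≤ 2 * (1 + ‖v‖ ^ 2) := by
    calc Real.sqrt (‖v‖ ^ 2 + 3) ≤ Real.sqrt ((‖v‖ ^ 2 + 2) ^ 2) := Real.sqrt_le_sqrt (by nlinarith [sq_nonneg ‖v‖])
      _ = ‖v‖ ^ 2 + 2 := Real.sqrt_sq (by positivity)
      _ ≤ 2 * (1 + ‖v‖ ^ 2) := by nlinarith [sq_nonneg ‖v‖]
  nlinarith [Real.pi_pos]

/-- **The estimate per position slice.** With `k = 2πε ≤ π/2`, `Ψ(x, ω) = ∫ κ(x, U) I₀^R(U, ω) dU`,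
the criticality kernel `k₀` of (K0) and the dipole remainder `e` of (K2): at a fixed `x ∈ 𝕋³`,
`|cos(2πx₀) ∫ Ψ(x, ·) dσ + ∫ [cos(2πx₀)cos(kω₀) + sin(2πx₀)sin(kω₀)] Ψ(x, ω) dσ − cos(2πx₀)(Φ₃ + Φ₄)
  − π²ε sin(2πx₀) ∫ Θ₀^R U₀ κ(x, U) dU| ≤ C ∫(1+|U|²)|k₀| + (k²/2 + k³/6) C Λ + k C ∫|U₀|(1+|U|²)|e| + 1040πC`
(`Λ = ∫ (1+|U|²) ∫_{S²} I₀^R dσ dU`; Fubini on `S² × ℝ³`, `2∫I₀ dσ − νΘ₀ = k₀(|U|²)`,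
`∫ ω₀ I₀ dσ = U₀(π/2 Θ₀ + e)`, `k · π/2 = π²ε`, and the two trigonometric remainders). [cite: CIP1994, §3.1] -/
theorem k2r_ref_ok0_slice_estimate {R : ℝ} (hR : 1 ≤ R) {ε C : ℝ} (hε : 0 ≤ ε) (hk : 2 * π * ε ≤ π / 2)
    (hC : 0 ≤ C) {κ : T3 → V3 → ℝ} (hκ : Continuous (uncurry κ)) (hκb : ∀ x v, |κ x v| ≤ C * (1 + ‖v‖ ^ 2))
    {k e : ℝ → ℝ} (hkm : Measurable k)
    (hkU : ∀ U : V3, k (‖U‖ ^ 2) = 2 * (∫ ω, I R U ω ∂(sphereMeasure : Measure (Metric.sphere (0 : V3) 1))) -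
      collisionFrequency U * Θ R U)
    (hkI : Integrable (fun U : V3 => (1 + ‖U‖ ^ 2) * |k (‖U‖ ^ 2)|)) (hem : Measurable e)
    (heU : ∀ U : V3, ∫ ω, (ω : V3) 0 * I R U ω ∂(sphereMeasure : Measure (Metric.sphere (0 : V3) 1)) =
      U 0 * (π / 2 * Θ R U + e (‖U‖ ^ 2)))
    (heI : Integrable (fun U : V3 => |U 0| * (1 + ‖U‖ ^ 2) * |e (‖U‖ ^ 2)|))
    (Ψ : T3 → Metric.sphere (0 : V3) 1 → ℝ) (hΨ : ∀ x ω, Ψ x ω = ∫ U : V3, κ x U * I R U ω) (x : T3)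
    (hgi : Integrable (fun U : V3 => Θ R U * (collisionFrequency U * κ x U))) {Φ₄ : ℝ}
    (hΦ₄ : |Φ₄| ≤ 1040 * π * C) :
    |Torus.cosCoord 0 x * (∫ ω, Ψ x ω ∂(sphereMeasure : Measure (Metric.sphere (0 : V3) 1))) +
        (∫ ω, (Torus.cosCoord 0 x * Real.cos (2 * π * ε * (ω : V3) 0) +
          Torus.sinCoord 0 x * Real.sin (2 * π * ε * (ω : V3) 0)) * Ψ x ω
            ∂(sphereMeasure : Measure (Metric.sphere (0 : V3) 1))) -
        Torus.cosCoord 0 x * (∫ U : V3, Θ R U * (collisionFrequency U * κ x U)) -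
        Torus.cosCoord 0 x * Φ₄ -
        π ^ 2 * ε * (Torus.sinCoord 0 x * ∫ U : V3, Θ R U * U 0 * κ x U)| ≤
      C * (∫ U : V3, (1 + ‖U‖ ^ 2) * |k (‖U‖ ^ 2)|) +
        ((2 * π * ε) ^ 2 / 2 + (2 * π * ε) ^ 3 / 6) * C *
          (∫ U : V3, (1 + ‖U‖ ^ 2) * ∫ ω, I R U ω ∂(sphereMeasure : Measure (Metric.sphere (0 : V3) 1))) +
        2 * π * ε * C * (∫ U : V3, |U 0| * (1 + ‖U‖ ^ 2) * |e (‖U‖ ^ 2)|) + 1040 * π * C := by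
  haveI := isFiniteMeasure_sphereMeasure (E := V3)
  have hR0 : 0 < R := by linarith
  obtain ⟨hw01, hwc, -, hw4⟩ := k2r_ref_ok0_w_facts hΘ hR
  obtain ⟨-, hIsec⟩ := k2r_ref_ok0_continuous_I' hI hR0
  have hI0 := k2r_ref_ok0_I_nonneg hΘ hI hR
  obtain ⟨hΛi, -⟩ := k2r_ref_ok0_Lambda_le hΘ hI hR
  set k₀ : ℝ := 2 * π * ε with hk₀
  have hk₀0 : 0 ≤ k₀ := by positivity
  have hkπ : k₀ * (π / 2) = π ^ 2 * ε := by rw [hk₀]; ring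
  set cx : ℝ := Torus.cosCoord 0 x with hcx
  set sx : ℝ := Torus.sinCoord 0 x with hsx
  have hcx1 : |cx| ≤ 1 := Torus.abs_cosCoord_le 0 x
  have hsx1 : |sx| ≤ 1 := by
    obtain ⟨r, hr⟩ := Torus.exists_coe_eq (x 0)
    rw [hsx, Torus.sinCoord_of_eq hr.symm]
    exact Real.abs_sin_le_one _
  have hκx : Continuous fun U : V3 => κ x U := hκ.comp (continuous_const.prodMk continuous_id)
  have hκm : Measurable fun U : V3 => κ x U := hκx.measurable
  -- the three sphere weights
  have hω0 : Continuous fun ω : Metric.sphere (0 : V3) 1 => (ω : V3) 0 :=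
    (EuclideanSpace.proj (0 : Fin 3)).continuous.comp continuous_subtype_val
  set c : Metric.sphere (0 : V3) 1 → ℝ := fun ω => cx * Real.cos (k₀ * (ω : V3) 0) + sx * Real.sin (k₀ * (ω : V3) 0)
    with hc
  set c₁ : Metric.sphere (0 : V3) 1 → ℝ := fun ω => Real.cos (k₀ * (ω : V3) 0) - 1 with hc₁
  set c₃ : Metric.sphere (0 : V3) 1 → ℝ := fun ω => Real.sin (k₀ * (ω : V3) 0) - k₀ * (ω : V3) 0 with hc₃
  have hcc : Continuous c := (continuous_const.mul (Real.continuous_cos.comp (hω0.const_smul k₀))).add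
    (continuous_const.mul (Real.continuous_sin.comp (hω0.const_smul k₀)))
  have hc₁c : Continuous c₁ := (Real.continuous_cos.comp (hω0.const_smul k₀)).sub continuous_const
  have hc₃c : Continuous c₃ := (Real.continuous_sin.comp (hω0.const_smul k₀)).sub (hω0.const_smul k₀)
  have hcb : ∀ ω, |c ω| ≤ 2 := fun ω => by
    refine (abs_add_le _ _).trans ?_
    rw [abs_mul, abs_mul]
    nlinarith [Real.abs_cos_le_one (k₀ * (ω : V3) 0), Real.abs_sin_le_one (k₀ * (ω : V3) 0),
      abs_nonneg cx, abs_nonneg sx, abs_nonneg (Real.cos (k₀ * (ω : V3) 0)), abs_nonneg (Real.sin (k₀ * (ω : V3) 0))]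
  have hc₁b : ∀ ω, |c₁ ω| ≤ k₀ ^ 2 / 2 := fun ω => (stub_operatorKappaZero_prep3 k₀ hk₀0 hk ω).1
  have hc₃b : ∀ ω, |c₃ ω| ≤ k₀ ^ 3 / 6 := fun ω => (stub_operatorKappaZero_prep3 k₀ hk₀0 hk ω).2
  -- Fubini exchanges on `S² × ℝ³`
  obtain ⟨-, hi1, -, hF1⟩ := k2r_ref_ok0_fubini_SV hΘ hI hR hκm (hκb x) (c := fun _ => (1 : ℝ))
    measurable_const (cB := 1) (fun _ => by rw [abs_one])
  simp only [one_mul] at hi1 hF1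
  obtain ⟨-, hi2, -, hF2⟩ := k2r_ref_ok0_fubini_SV hΘ hI hR hκm (hκb x) hcc.measurable hcb
  obtain ⟨-, hib, hibs, -⟩ := k2r_ref_ok0_fubini_SV hΘ hI hR hκm (hκb x) hc₁c.measurable hc₁b
  obtain ⟨-, hif, hifs, -⟩ := k2r_ref_ok0_fubini_SV hΘ hI hR hκm (hκb x) hc₃c.measurable hc₃b
  -- the phase, per outgoing velocity
  have hsph : ∀ U : V3, ∫ ω, c ω * I R U ω ∂(sphereMeasure : Measure (Metric.sphere (0 : V3) 1)) =
      cx * (∫ ω, I R U ω ∂(sphereMeasure : Measure (Metric.sphere (0 : V3) 1))) +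
      cx * (∫ ω, c₁ ω * I R U ω ∂(sphereMeasure : Measure (Metric.sphere (0 : V3) 1))) +
      sx * (k₀ * (U 0 * (π / 2 * Θ R U + e (‖U‖ ^ 2)))) +
      sx * (∫ ω, c₃ ω * I R U ω ∂(sphereMeasure : Measure (Metric.sphere (0 : V3) 1))) := by
    intro U
    have i0 : Integrable (fun ω : Metric.sphere (0 : V3) 1 => cx * I R U ω) (sphereMeasure : Measure (Metric.sphere (0 : V3) 1)) :=
      (ClampedCorrectorBirth.integrable_sphere_of_continuous' (hIsec U)).const_mul cx
    have i1 : Integrable (fun ω => cx * (c₁ ω * I R U ω)) (sphereMeasure : Measure (Metric.sphere (0 : V3) 1)) :=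
      (hibs U).const_mul cx
    have i2 : Integrable (fun ω : Metric.sphere (0 : V3) 1 => sx * (k₀ * ((ω : V3) 0 * I R U ω)))
        (sphereMeasure : Measure (Metric.sphere (0 : V3) 1)) :=
      ((ClampedCorrectorBirth.integrable_sphere_of_continuous' (hω0.mul (hIsec U))).const_mul k₀).const_mul sx
    have i3 : Integrable (fun ω => sx * (c₃ ω * I R U ω)) (sphereMeasure : Measure (Metric.sphere (0 : V3) 1)) :=
      (hifs U).const_mul sx
    rw [← heU U]
    have he1 : ∀ ω : Metric.sphere (0 : V3) 1, c ω * I R U ω = cx * I R U ω + cx * (c₁ ω * I R U ω) +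
        sx * (k₀ * ((ω : V3) 0 * I R U ω)) + sx * (c₃ ω * I R U ω) := fun ω => by
      simp only [hc, hc₁, hc₃]; ring
    have i01 : Integrable (fun ω : Metric.sphere (0 : V3) 1 => cx * I R U ω + cx * (c₁ ω * I R U ω))
        (sphereMeasure : Measure (Metric.sphere (0 : V3) 1)) := i0.add i1
    have i012 : Integrable (fun ω : Metric.sphere (0 : V3) 1 => cx * I R U ω + cx * (c₁ ω * I R U ω) +
        sx * (k₀ * ((ω : V3) 0 * I R U ω))) (sphereMeasure : Measure (Metric.sphere (0 : V3) 1)) := i01.add i2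
    rw [integral_congr_ae (Eventually.of_forall he1), integral_add i012 i3, integral_add i01 i2, integral_add i0 i1,
      integral_const_mul, integral_const_mul, integral_const_mul, integral_const_mul, integral_const_mul]
  -- the five integrable functions of the outgoing velocity
  have ha : Integrable (fun U : V3 => κ x U * k (‖U‖ ^ 2)) := by
    refine (hkI.const_mul C).mono' (hκm.mul (hkm.comp (by fun_prop))).aestronglyMeasurable
      (Eventually.of_forall fun U => ?_)
    rw [Real.norm_eq_abs, abs_mul]
    exact (mul_le_mul_of_nonneg_right (hκb x U) (abs_nonneg _)).trans_eq (by ring)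
  have hd : Integrable (fun U : V3 => U 0 * e (‖U‖ ^ 2) * κ x U) := by
    refine (heI.const_mul C).mono' ?_ (Eventually.of_forall fun U => ?_)
    · exact (((EuclideanSpace.proj (0 : Fin 3)).continuous.measurable.mul (hem.comp (by fun_prop))).mul
        hκm).aestronglyMeasurable
    · rw [Real.norm_eq_abs, abs_mul, abs_mul]
      calc |U 0| * |e (‖U‖ ^ 2)| * |κ x U| ≤ |U 0| * |e (‖U‖ ^ 2)| * (C * (1 + ‖U‖ ^ 2)) :=
            mul_le_mul_of_nonneg_left (hκb x U) (by positivity)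
        _ = C * (|U 0| * (1 + ‖U‖ ^ 2) * |e (‖U‖ ^ 2)|) := by ring
  have hmI : Integrable (fun U : V3 => Θ R U * U 0 * κ x U) := by
    refine (hw4.const_mul C).mono' ((hwc.measurable.mul (EuclideanSpace.proj (0 : Fin 3)).continuous.measurable).mul
      hκm).aestronglyMeasurable (Eventually.of_forall fun U => ?_)
    rw [Real.norm_eq_abs, abs_mul, abs_mul, abs_of_nonneg (hw01 U).1]
    have hU0 : |U 0| ≤ ‖U‖ := by simpa using PiLp.norm_apply_le U 0
    have h14 : ‖U‖ * (1 + ‖U‖ ^ 2) ≤ (1 + ‖U‖ ^ 2) ^ 4 := by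
      have h1 : ‖U‖ ≤ 1 + ‖U‖ ^ 2 := by nlinarith [sq_nonneg (‖U‖ - 1), norm_nonneg U]
      calc ‖U‖ * (1 + ‖U‖ ^ 2) ≤ (1 + ‖U‖ ^ 2) * (1 + ‖U‖ ^ 2) := by gcongr
        _ = (1 + ‖U‖ ^ 2) ^ 2 := (sq _).symm
        _ ≤ (1 + ‖U‖ ^ 2) ^ 4 := pow_le_pow_right₀ (by nlinarith [sq_nonneg ‖U‖]) (by norm_num)
    calc Θ R U * |U 0| * |κ x U| ≤ Θ R U * ‖U‖ * (C * (1 + ‖U‖ ^ 2)) := by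
          gcongr
          · exact mul_nonneg (hw01 U).1 (norm_nonneg U)
          · exact (hw01 U).1
          · exact hκb x U
      _ = C * (Θ R U * (‖U‖ * (1 + ‖U‖ ^ 2))) := by ring
      _ ≤ C * (Θ R U * (1 + ‖U‖ ^ 2) ^ 4) := by gcongr; exact (hw01 U).1
  -- the integrand identity and its integral
  have hpt : ∀ U : V3, cx * (κ x U * ∫ ω, I R U ω ∂(sphereMeasure : Measure (Metric.sphere (0 : V3) 1))) +
      κ x U * (∫ ω, c ω * I R U ω ∂(sphereMeasure : Measure (Metric.sphere (0 : V3) 1))) -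
      cx * (Θ R U * (collisionFrequency U * κ x U)) =
      cx * (κ x U * k (‖U‖ ^ 2)) + cx * (κ x U * ∫ ω, c₁ ω * I R U ω ∂(sphereMeasure : Measure (Metric.sphere (0 : V3) 1))) +
      k₀ * (π / 2) * (sx * (Θ R U * U 0 * κ x U)) + k₀ * (sx * (U 0 * e (‖U‖ ^ 2) * κ x U)) +
      sx * (κ x U * ∫ ω, c₃ ω * I R U ω ∂(sphereMeasure : Measure (Metric.sphere (0 : V3) 1))) := fun U => by
    rw [hsph U, hkU U]; ring
  have hLHS : ∫ U : V3, (cx * (κ x U * ∫ ω, I R U ω ∂(sphereMeasure : Measure (Metric.sphere (0 : V3) 1))) +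
      κ x U * (∫ ω, c ω * I R U ω ∂(sphereMeasure : Measure (Metric.sphere (0 : V3) 1))) -
      cx * (Θ R U * (collisionFrequency U * κ x U))) =
      cx * (∫ ω, Ψ x ω ∂(sphereMeasure : Measure (Metric.sphere (0 : V3) 1))) +
      (∫ ω, c ω * Ψ x ω ∂(sphereMeasure : Measure (Metric.sphere (0 : V3) 1))) -
      cx * (∫ U : V3, Θ R U * (collisionFrequency U * κ x U)) := by
    have j1 : Integrable (fun U : V3 => cx * (κ x U * ∫ ω, I R U ω ∂(sphereMeasure : Measure (Metric.sphere (0 : V3) 1)))) :=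
      hi1.const_mul cx
    have j12 : Integrable (fun U : V3 => cx * (κ x U * ∫ ω, I R U ω ∂(sphereMeasure : Measure (Metric.sphere (0 : V3) 1))) +
        κ x U * (∫ ω, c ω * I R U ω ∂(sphereMeasure : Measure (Metric.sphere (0 : V3) 1)))) := j1.add hi2
    have j3 : Integrable (fun U : V3 => cx * (Θ R U * (collisionFrequency U * κ x U))) := hgi.const_mul cx
    rw [integral_sub j12 j3, integral_add j1 hi2, integral_const_mul, integral_const_mul, ← hF1, ← hF2]
    simp only [hΨ]
  have hRHS : ∫ U : V3, (cx * (κ x U * k (‖U‖ ^ 2)) +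
      cx * (κ x U * ∫ ω, c₁ ω * I R U ω ∂(sphereMeasure : Measure (Metric.sphere (0 : V3) 1))) +
      k₀ * (π / 2) * (sx * (Θ R U * U 0 * κ x U)) + k₀ * (sx * (U 0 * e (‖U‖ ^ 2) * κ x U)) +
      sx * (κ x U * ∫ ω, c₃ ω * I R U ω ∂(sphereMeasure : Measure (Metric.sphere (0 : V3) 1)))) =
      cx * (∫ U : V3, κ x U * k (‖U‖ ^ 2)) +
      cx * (∫ U : V3, κ x U * ∫ ω, c₁ ω * I R U ω ∂(sphereMeasure : Measure (Metric.sphere (0 : V3) 1))) +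
      k₀ * (π / 2) * (sx * ∫ U : V3, Θ R U * U 0 * κ x U) + k₀ * (sx * ∫ U : V3, U 0 * e (‖U‖ ^ 2) * κ x U) +
      sx * (∫ U : V3, κ x U * ∫ ω, c₃ ω * I R U ω ∂(sphereMeasure : Measure (Metric.sphere (0 : V3) 1))) := by
    have j1 : Integrable (fun U : V3 => cx * (κ x U * k (‖U‖ ^ 2))) := ha.const_mul cx
    have j2 : Integrable (fun U : V3 => cx * (κ x U * ∫ ω, c₁ ω * I R U ω
        ∂(sphereMeasure : Measure (Metric.sphere (0 : V3) 1)))) := hib.const_mul cx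
    have j3 : Integrable (fun U : V3 => k₀ * (π / 2) * (sx * (Θ R U * U 0 * κ x U))) :=
      (hmI.const_mul sx).const_mul (k₀ * (π / 2))
    have j4 : Integrable (fun U : V3 => k₀ * (sx * (U 0 * e (‖U‖ ^ 2) * κ x U))) := (hd.const_mul sx).const_mul k₀
    have j5 : Integrable (fun U : V3 => sx * (κ x U * ∫ ω, c₃ ω * I R U ω
        ∂(sphereMeasure : Measure (Metric.sphere (0 : V3) 1)))) := hif.const_mul sx
    have j12 : Integrable (fun U : V3 => cx * (κ x U * k (‖U‖ ^ 2)) + cx * (κ x U * ∫ ω, c₁ ω * I R U ω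
        ∂(sphereMeasure : Measure (Metric.sphere (0 : V3) 1)))) := j1.add j2
    have j123 : Integrable (fun U : V3 => cx * (κ x U * k (‖U‖ ^ 2)) + cx * (κ x U * ∫ ω, c₁ ω * I R U ω
        ∂(sphereMeasure : Measure (Metric.sphere (0 : V3) 1))) + k₀ * (π / 2) * (sx * (Θ R U * U 0 * κ x U))) :=
      j12.add j3
    have j1234 : Integrable (fun U : V3 => cx * (κ x U * k (‖U‖ ^ 2)) + cx * (κ x U * ∫ ω, c₁ ω * I R U ω
        ∂(sphereMeasure : Measure (Metric.sphere (0 : V3) 1))) + k₀ * (π / 2) * (sx * (Θ R U * U 0 * κ x U)) +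
        k₀ * (sx * (U 0 * e (‖U‖ ^ 2) * κ x U))) := j123.add j4
    rw [integral_add j1234 j5, integral_add j123 j4, integral_add j12 j3, integral_add j1 j2, integral_const_mul,
      integral_const_mul, integral_const_mul, integral_const_mul, integral_const_mul, integral_const_mul,
      integral_const_mul]
  have hkey : cx * (∫ ω, Ψ x ω ∂(sphereMeasure : Measure (Metric.sphere (0 : V3) 1))) +
      (∫ ω, c ω * Ψ x ω ∂(sphereMeasure : Measure (Metric.sphere (0 : V3) 1))) -
      cx * (∫ U : V3, Θ R U * (collisionFrequency U * κ x U)) =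
      cx * (∫ U : V3, κ x U * k (‖U‖ ^ 2)) +
      cx * (∫ U : V3, κ x U * ∫ ω, c₁ ω * I R U ω ∂(sphereMeasure : Measure (Metric.sphere (0 : V3) 1))) +
      k₀ * (π / 2) * (sx * ∫ U : V3, Θ R U * U 0 * κ x U) + k₀ * (sx * ∫ U : V3, U 0 * e (‖U‖ ^ 2) * κ x U) +
      sx * (∫ U : V3, κ x U * ∫ ω, c₃ ω * I R U ω ∂(sphereMeasure : Measure (Metric.sphere (0 : V3) 1))) := by
    rw [← hLHS, ← hRHS]
    exact integral_congr_ae (Eventually.of_forall hpt)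
  -- the four bounds
  have hB1 : |∫ U : V3, κ x U * k (‖U‖ ^ 2)| ≤ C * ∫ U : V3, (1 + ‖U‖ ^ 2) * |k (‖U‖ ^ 2)| := by
    rw [← Real.norm_eq_abs, ← integral_const_mul]
    refine norm_integral_le_of_norm_le (hkI.const_mul C) (Eventually.of_forall fun U => ?_)
    rw [Real.norm_eq_abs, abs_mul]
    exact (mul_le_mul_of_nonneg_right (hκb x U) (abs_nonneg _)).trans_eq (by ring)
  have hGb : ∀ {c' : Metric.sphere (0 : V3) 1 → ℝ} {B : ℝ}, (∀ ω, |c' ω| ≤ B) →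
      (∀ U, Integrable (fun ω => c' ω * I R U ω) (sphereMeasure : Measure (Metric.sphere (0 : V3) 1))) →
      ∀ U : V3, |κ x U * ∫ ω, c' ω * I R U ω ∂(sphereMeasure : Measure (Metric.sphere (0 : V3) 1))| ≤
        B * C * ((1 + ‖U‖ ^ 2) * ∫ ω, I R U ω ∂(sphereMeasure : Measure (Metric.sphere (0 : V3) 1))) := by
    intro c' B hB hci U
    have h1 : |∫ ω, c' ω * I R U ω ∂(sphereMeasure : Measure (Metric.sphere (0 : V3) 1))| ≤
        B * ∫ ω, I R U ω ∂(sphereMeasure : Measure (Metric.sphere (0 : V3) 1)) := by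
      rw [← Real.norm_eq_abs, ← integral_const_mul]
      refine norm_integral_le_of_norm_le ((ClampedCorrectorBirth.integrable_sphere_of_continuous'
        (hIsec U)).const_mul B) (Eventually.of_forall fun ω => ?_)
      rw [Real.norm_eq_abs, abs_mul, abs_of_nonneg (hI0 ω U)]
      exact mul_le_mul_of_nonneg_right (hB ω) (hI0 ω U)
    have hI' : 0 ≤ ∫ ω, I R U ω ∂(sphereMeasure : Measure (Metric.sphere (0 : V3) 1)) :=
      integral_nonneg fun ω => hI0 ω U
    have hB0 : 0 ≤ B := (abs_nonneg _).trans (hB ⟨EuclideanSpace.single 0 1, by simp⟩)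
    rw [abs_mul]
    calc |κ x U| * |∫ ω, c' ω * I R U ω ∂(sphereMeasure : Measure (Metric.sphere (0 : V3) 1))|
        ≤ C * (1 + ‖U‖ ^ 2) * (B * ∫ ω, I R U ω ∂(sphereMeasure : Measure (Metric.sphere (0 : V3) 1))) :=
          mul_le_mul (hκb x U) h1 (abs_nonneg _) (by positivity)
      _ = B * C * ((1 + ‖U‖ ^ 2) * ∫ ω, I R U ω ∂(sphereMeasure : Measure (Metric.sphere (0 : V3) 1))) := by ring
  have hB2 : |∫ U : V3, κ x U * ∫ ω, c₁ ω * I R U ω ∂(sphereMeasure : Measure (Metric.sphere (0 : V3) 1))| ≤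
      k₀ ^ 2 / 2 * C * ∫ U : V3, (1 + ‖U‖ ^ 2) * ∫ ω, I R U ω ∂(sphereMeasure : Measure (Metric.sphere (0 : V3) 1)) := by
    rw [← Real.norm_eq_abs, ← integral_const_mul]
    exact norm_integral_le_of_norm_le (hΛi.const_mul _) (Eventually.of_forall fun U => by
      rw [Real.norm_eq_abs]; exact hGb hc₁b hibs U)
  have hB4 : |∫ U : V3, κ x U * ∫ ω, c₃ ω * I R U ω ∂(sphereMeasure : Measure (Metric.sphere (0 : V3) 1))| ≤
      k₀ ^ 3 / 6 * C * ∫ U : V3, (1 + ‖U‖ ^ 2) * ∫ ω, I R U ω ∂(sphereMeasure : Measure (Metric.sphere (0 : V3) 1)) := by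
    rw [← Real.norm_eq_abs, ← integral_const_mul]
    exact norm_integral_le_of_norm_le (hΛi.const_mul _) (Eventually.of_forall fun U => by
      rw [Real.norm_eq_abs]; exact hGb hc₃b hifs U)
  have hB3 : |∫ U : V3, U 0 * e (‖U‖ ^ 2) * κ x U| ≤ C * ∫ U : V3, |U 0| * (1 + ‖U‖ ^ 2) * |e (‖U‖ ^ 2)| := by
    rw [← Real.norm_eq_abs, ← integral_const_mul]
    refine norm_integral_le_of_norm_le (heI.const_mul C) (Eventually.of_forall fun U => ?_)
    rw [Real.norm_eq_abs, abs_mul, abs_mul]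
    calc |U 0| * |e (‖U‖ ^ 2)| * |κ x U| ≤ |U 0| * |e (‖U‖ ^ 2)| * (C * (1 + ‖U‖ ^ 2)) :=
          mul_le_mul_of_nonneg_left (hκb x U) (by positivity)
      _ = C * (|U 0| * (1 + ‖U‖ ^ 2) * |e (‖U‖ ^ 2)|) := by ring
  -- conclusion
  have hcΨ : (∫ ω, (cx * Real.cos (k₀ * (ω : V3) 0) + sx * Real.sin (k₀ * (ω : V3) 0)) * Ψ x ω
      ∂(sphereMeasure : Measure (Metric.sphere (0 : V3) 1))) =
      ∫ ω, c ω * Ψ x ω ∂(sphereMeasure : Measure (Metric.sphere (0 : V3) 1)) := rfl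
  rw [hcΨ]
  set A1 := ∫ U : V3, κ x U * k (‖U‖ ^ 2)
  set A2 := ∫ U : V3, κ x U * ∫ ω, c₁ ω * I R U ω ∂(sphereMeasure : Measure (Metric.sphere (0 : V3) 1))
  set A3 := ∫ U : V3, U 0 * e (‖U‖ ^ 2) * κ x U
  set A4 := ∫ U : V3, κ x U * ∫ ω, c₃ ω * I R U ω ∂(sphereMeasure : Measure (Metric.sphere (0 : V3) 1))
  set Mm := ∫ U : V3, Θ R U * U 0 * κ x U
  have hE : cx * (∫ ω, Ψ x ω ∂(sphereMeasure : Measure (Metric.sphere (0 : V3) 1))) +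
      (∫ ω, c ω * Ψ x ω ∂(sphereMeasure : Measure (Metric.sphere (0 : V3) 1))) -
      cx * (∫ U : V3, Θ R U * (collisionFrequency U * κ x U)) - cx * Φ₄ - π ^ 2 * ε * (sx * Mm) =
      cx * A1 + cx * A2 + k₀ * (sx * A3) + sx * A4 - cx * Φ₄ := by
    rw [hkey, ← hkπ]; ring
  rw [hE]
  have hΛ0 : 0 ≤ ∫ U : V3, (1 + ‖U‖ ^ 2) * ∫ ω, I R U ω ∂(sphereMeasure : Measure (Metric.sphere (0 : V3) 1)) :=
    integral_nonneg fun U => mul_nonneg (by positivity) (integral_nonneg fun ω => hI0 ω U)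
  have e1 : |cx * A1| ≤ C * ∫ U : V3, (1 + ‖U‖ ^ 2) * |k (‖U‖ ^ 2)| := by
    rw [abs_mul]; exact (mul_le_mul hcx1 hB1 (abs_nonneg _) zero_le_one).trans_eq (one_mul _)
  have e2 : |cx * A2| ≤ k₀ ^ 2 / 2 * C *
      ∫ U : V3, (1 + ‖U‖ ^ 2) * ∫ ω, I R U ω ∂(sphereMeasure : Measure (Metric.sphere (0 : V3) 1)) := by
    rw [abs_mul]; exact (mul_le_mul hcx1 hB2 (abs_nonneg _) zero_le_one).trans_eq (one_mul _)
  have e3 : |k₀ * (sx * A3)| ≤ k₀ * (C * ∫ U : V3, |U 0| * (1 + ‖U‖ ^ 2) * |e (‖U‖ ^ 2)|) := by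
    rw [abs_mul, abs_of_nonneg hk₀0, abs_mul]
    exact mul_le_mul_of_nonneg_left ((mul_le_mul hsx1 hB3 (abs_nonneg _) zero_le_one).trans_eq (one_mul _)) hk₀0
  have e4 : |sx * A4| ≤ k₀ ^ 3 / 6 * C *
      ∫ U : V3, (1 + ‖U‖ ^ 2) * ∫ ω, I R U ω ∂(sphereMeasure : Measure (Metric.sphere (0 : V3) 1)) := by
    rw [abs_mul]; exact (mul_le_mul hsx1 hB4 (abs_nonneg _) zero_le_one).trans_eq (one_mul _)
  have e5 : |cx * Φ₄| ≤ 1040 * π * C := by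
    rw [abs_mul]; exact (mul_le_mul hcx1 hΦ₄ (abs_nonneg _) zero_le_one).trans_eq (one_mul _)
  calc |cx * A1 + cx * A2 + k₀ * (sx * A3) + sx * A4 - cx * Φ₄|
      ≤ |cx * A1| + |cx * A2| + |k₀ * (sx * A3)| + |sx * A4| + |cx * Φ₄| := by
        refine (abs_sub _ _).trans (add_le_add ((abs_add_le _ _).trans (add_le_add ((abs_add_le _ _).trans
          (add_le_add (abs_add_le _ _) le_rfl)) le_rfl)) le_rfl)
    _ ≤ _ := by linarith [e1, e2, e3, e4, e5]

end Summit.AtomisticToContinuum.HydrodynamicLimit.Theorems.EnskogAdjointDuality
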